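import Summits.AtomisticToContinuum.Crystallization.Theorems.FreeSplittingCertificatesAssembly
import Summits.AtomisticToContinuum.Crystallization.Theorems.FreeSplittingCertificatesRadiusLadderRadiusFloor
import Summits.AtomisticToContinuum.Crystallization.Theorems.FreeSplittingCertificatesSlackDensity
import Summits.AtomisticToContinuum.Crystallization.Theorems.ChessboardParticlePlanesLjLaminarWindowsMinDistance

/-!
# `StrictSplittingRule` / `FiniteRangeSplitting` (stmt-AtomisticToContinuum-12560 / -12559):
# what the summit consumes of the cruxes — certificates ON GROUND STATES, at the ground-state hard core

Route `FreeSplittingCertificates`.  Its cruxes r2 (`FiniteRangeSplitting`: a finite-range pair-splitting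
rule FEASIBLE on all `δ`-separated configurations, for every hard core `δ > 0`) and r3
(`StrictSplittingRule`: feasible AND strict toward the stretched hcp shell, for every `δ > 0`) quantify
over ALL finite `δ`-separated configurations and over ALL hard cores.  The route's deciding theorem
`closes` reaches `Crystallization` through the support `DefectVanishOfStrict`, whose landed proof
(`defectVanishOfStrict_proof`) uses r3 at ONE hard core only — a `δ₀` below the minimal interparticle
distance of Lennard-Jones ground states — and uses feasibility / strictness only ON GROUND STATES.

This file makes that bookkeeping explicit and joins it to two landed facts:

* the tree's best ground-state hard core, `7/10`: every Lennard-Jones ground state in `ℝ³` is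
  `7/10`-separated (`LjLaminarWindowsSketch.stub_minDistance07`, route ChessboardParticlePlanes, which
  sharpens Yuhjtman 2015, Cor. 7, `0.684`, itself proved in the tree as `Yuhjtman2015_minDistance_holds`);
* the radius ladder of crux r2 (`RungAt δ R`, files `…RadiusLadder*`): `FiniteRangeSplitting ↔
  ∃ R ≥ δ_½, RungAt (2/5) R` (`finiteRangeSplitting_iff_rung_two_fifths_floor`), monotonicity in the hard
  core (`rungAt_mono_sep`) and the radius floor `δ_½ ≤ R` below the half-rule threshold
  (`threshold_le_radius_of_rungAt`).

## Results (all sorry-free; no new definitions)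

1. `defectVanish_of_groundStateCertificate`: a rule `Φ` (box + complementarity) of ANY radius `R` that is
   feasible (`siteE ≥ e_∞`) and strict toward `S(a,t)` AT THE SITES OF GROUND STATES ONLY, together with
   `ShellRigidityHcp`, gives the defect-vanishing conclusion of `DefectVanishOfStrict`; hence
   (`crystallization_of_groundStateCertificate`) `Crystallization`, by the landed glue
   `defectVanishEnergy_proof periodicUpperBound_proof` and `defectVanishCrystallizes_proof`.
2. `groundStateCertificate_of_strictSplittingRule`: crux r3 implies such a ground-state certificate
   (instantiate `δ = 7/10`); so `closes` factors through (1) — the summit consumes r3 only on ground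
   states.  `crystallization_of_strictAt`: for ANY `δ` such that all ground states are `δ`-separated,
   ONE rule feasible and strict on `δ`-separated configurations (the `δ`-instance of r3, radius free)
   plus `ShellRigidityHcp` gives `Crystallization`; unconditional instance `δ = 7/10`
   (`crystallization_of_strictAt_seven_tenths`).
3. The r2 side at the ground-state core: `FiniteRangeSplitting → ∃ R ≥ δ_½, RungAt (7/10) R`
   (`rungAt_groundStateCore_of_finiteRangeSplitting`); a rung at hard core `7/10` puts the hypothesis of
   the support `SlackDensity` (feasibility on ground states) at finite range
   (`groundStateFeasible_of_rungAt_seven_tenths`); every such rung reads radius `R ≥ δ_½ ≥ 47/50`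
   (`threshold_le_radius_of_rungAt_seven_tenths`) and is a rung at the hard core `4/5` of the decided
   `R = 2` cell (`rungAt_four_fifths_of_rungAt_seven_tenths`); joined to the landed support `SlackDensity`
   (`slackDensity_proof`), a rung at a ground-state hard core yields a finite-range rule under which, along
   every ground-state sequence, all but a vanishing fraction of the sites have weighted site energy within
   any `c > 0` of `e_∞` (`slackVanish_of_rungAt`, `slackVanish_of_rungAt_seven_tenths`).

## Reading for the `R = 2` rung `RungAt (4/5) 2` (cell b2b-freesplit, verdict NOT REFUTED)

The rung is NECESSARY for a radius-`2` certificate at the tree's ground-state core `7/10`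
(item 3), and it is SUFFICIENT for the summit-side use of r2/r3 at radius `2` exactly when all
Lennard-Jones ground states are `4/5`-separated (`crystallization_of_strictAt` /
`groundStateFeasible_of_rungAt` at `δ = 4/5`) — an unproved but numerically unchallenged property.
PLACEMENT of the hard core `4/5` (tree units: equilibrium distance `1`; in `σ`-units multiply by `2^{1/6}`,
so `4/5 ↦ 0.898σ`): PROVED lower bounds for the minimal distance in Lennard-Jones ground states are `7/10`
(`= 0.786σ`, tree, `LjLaminarWindowsSketch.stub_minDistance07`) and `0.684` (`= 0.7678σ`, the best bound
in print: Yuhjtman 2015, Cor. 7, after Xue 1997, Vinkó, Schachinger–Addis–Bomze–Schoen 2007); Kiessling–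
Wales (Mol. Phys. 2025, arXiv:2511.15008, §2.3) CONJECTURE `r_min > 1σ` (`= 2^{-1/6} ≈ 0.891` here) for
every global minimum and report `r_min ≈ 1.0136σ ≈ 0.903` as the smallest value over the putative global
minima with `N ≤ 1000` (attained at the centred Mackay icosahedron `N = 923`; crystal limit `≈ 1.09σ`).
Hence "all ground states are `4/5`-separated" is a CONSEQUENCE of the Kiessling–Wales conjecture and is
consistent with all numerics, while the tree's `7/10` is what is proved.  Honest framing: this file is
bookkeeping of landed theorems (a certificate of WHERE the cruxes are consumed), not progress on either
crux.  [cite: arXiv:2511.15008, §1 and §2.3; Yuhjtman2015, Cor. 7]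
-/

noncomputable section

namespace Summit.AtomisticToContinuum.Crystallization.Theorems.StrictSplittingRuleBirth

open scoped BigOperators Topology Classical
open Filter
open Literature.MathematicalPhysics.StatisticalMechanics
open Literature.Geometry.DiscreteGeometry
open Summit.AtomisticToContinuum.Crystallization.Theses.FreeSplittingCertificates
open Summit.AtomisticToContinuum.Crystallization.Theorems

/-! ## 1. Defect vanishing and crystallization from a certificate on ground states -/

/-- **Defect vanishing from a ground-state certificate.**  Let `Φ` be a pair-splitting rule (box +
complementarity) read at ANY radius `R`, FEASIBLE (`siteE R Φ x i ≥ e_∞`) and STRICT toward the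
stretched hcp shell `S(a,t)` (`siteE < e_∞ + c(η)` forces the first shell `η`-close to `S(a,t)`) at every
site of every Lennard-Jones GROUND STATE (nothing is asked on other configurations).  Then
`ShellRigidityHcp` yields one periodic `P` whose windows match all but a vanishing fraction of the sites
along every ground-state sequence (the conclusion of `DefectVanishOfStrict`).  Proof: the counting of
`defectVanishOfStrict_proof` verbatim, with the hard core `7/10` of ground states
(`LjLaminarWindowsSketch.stub_minDistance07`) feeding `ShellRigidityHcp` and the packing bound.
[folklore] -/
theorem defectVanish_of_groundStateCertificate (R : ℝ)
    (Φ : EuclideanSpace ℝ (Fin 3) → Finset (EuclideanSpace ℝ (Fin 3)) → ℝ) {a t : ℝ} (ha : 0 < a)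
    (ht : |t| ≤ 1 / 100) (hrule : IsRule Φ)
    (hfeas : ∀ (N : ℕ) (x : Fin N → EuclideanSpace ℝ (Fin 3)), IsGroundState lennardJones x →
      ∀ i : Fin N, eInf ≤ siteE R Φ x i)
    (hstrict : ∀ η : ℝ, 0 < η → ∃ c : ℝ, 0 < c ∧
      ∀ (N : ℕ) (x : Fin N → EuclideanSpace ℝ (Fin 3)), IsGroundState lennardJones x →
        ∀ k : Fin N, siteE R Φ x k < eInf + c → ShellCloseTo η (shell a x k) (target a t))
    (h₂ : ShellRigidityHcp) :
    ∃ P : PeriodicConfiguration 3, (∀ R' ε' : ℝ, 0 < R' → 0 < ε' →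
      ∀ x : (N : ℕ) → (Fin N → EuclideanSpace ℝ (Fin 3)),
        (∀ N, IsGroundState lennardJones (x N)) →
          Filter.Tendsto (fun N : ℕ => (Nat.card {i : Fin N // ¬ (∃ q ∈ P.points,
            ∃ A : EuclideanSpace ℝ (Fin 3) →ₗᵢ[ℝ] EuclideanSpace ℝ (Fin 3),
              (∀ p ∈ P.points, dist p q ≤ R' → ∃ j, dist (x N j) (x N i + A (p - q)) ≤ ε') ∧
              (∀ j, dist (x N j) (x N i) ≤ R' → ∃ p ∈ P.points,
                dist (x N j) (x N i + A (p - q)) ≤ ε'))} : ℝ) / N) Filter.atTop (nhds 0)) := by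
  obtain ⟨P, hP⟩ := h₂ a t ha ht
  refine ⟨P, fun R' ε' hR' hε' x hx => ?_⟩
  obtain ⟨η, hη, L, hL⟩ := hP (7 / 10) R' ε' (by norm_num) hR' hε'
  obtain ⟨c, hc, hstr⟩ := hstrict η hη
  obtain ⟨e, -, htend, hle⟩ := BlancLewin2015_8_holds 3 (by norm_num) (by norm_num)
  have he : e ≤ eInf := le_ciInf fun M => hle (M + 1) M.succ_pos
  set K : ℝ := (2 * max L 0 / (7 / 10) + 1) ^ 3 with hK_def
  have hK : 0 ≤ K := by positivity
  have main : ∀ N : ℕ, 0 < N →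
      (Nat.card {i : Fin N // ¬ (∃ q ∈ P.points,
        ∃ A : EuclideanSpace ℝ (Fin 3) →ₗᵢ[ℝ] EuclideanSpace ℝ (Fin 3),
          (∀ p ∈ P.points, dist p q ≤ R' → ∃ j, dist (x N j) (x N i + A (p - q)) ≤ ε') ∧
          (∀ j, dist (x N j) (x N i) ≤ R' → ∃ p ∈ P.points,
            dist (x N j) (x N i + A (p - q)) ≤ ε'))} : ℝ) / N ≤
        K / c * (groundStateEnergy lennardJones 3 N / N - e) := by
    intro N hN
    have hNr : (0 : ℝ) < N := by exact_mod_cast hN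
    have hgs : IsGroundState lennardJones (x N) := hx N
    have hsepN : ∀ i j, i ≠ j → (7 : ℝ) / 10 ≤ dist (x N i) (x N j) :=
      LjLaminarWindowsSketch.stub_minDistance07 N (x N) hgs
    have hsum : ∑ k, siteE R Φ (x N) k ≤ groundStateEnergy lennardJones 3 N :=
      le_of_eq ((defectVanishOfStrict_sum_weighted_eq lennardJones (x N) _
        (defectVanishOfStrict_weights_compl (x N) hgs.1 R Φ hrule.2)).trans hgs.2)
    have hcnt := defectVanishOfStrict_count (fun k => siteE R Φ (x N) k) eInf c
      (groundStateEnergy lennardJones 3 N) K hc hK _ _ _ (hfeas N (x N) hgs) hsum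
      (hstr N (x N) hgs) (hL N (x N) hsepN)
      (defectVanishOfStrict_card_near_le (x N) hgs.1 (by norm_num : (0 : ℝ) < 7 / 10) hsepN L)
    calc _ ≤ K / c * (groundStateEnergy lennardJones 3 N - N * eInf) / N :=
          div_le_div_of_nonneg_right hcnt hNr.le
      _ ≤ K / c * (groundStateEnergy lennardJones 3 N - N * e) / N := by
          gcongr
      _ = K / c * (groundStateEnergy lennardJones 3 N / N - e) := by
          rw [mul_div_assoc, sub_div, mul_div_cancel_left₀ _ hNr.ne']
  refine squeeze_zero' (Eventually.of_forall fun N => by positivity)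
    ((eventually_gt_atTop 0).mono main) ?_
  have hlim := (htend.sub_const e).const_mul (K / c)
  rwa [sub_self, mul_zero] at hlim

/-- **Crystallization from a ground-state certificate.**  Under the hypotheses of
`defectVanish_of_groundStateCertificate` (a rule of any radius, feasible and strict toward `S(a,t)` on
ground states only) and `ShellRigidityHcp`, the Lennard-Jones potential crystallizes in `ℝ³`: the landed
glue `defectVanishEnergy_proof periodicUpperBound_proof` and `defectVanishCrystallizes_proof` of the route
applied to the periodic configuration just produced.  [folklore] -/
theorem crystallization_of_groundStateCertificate (R : ℝ)
    (Φ : EuclideanSpace ℝ (Fin 3) → Finset (EuclideanSpace ℝ (Fin 3)) → ℝ) {a t : ℝ} (ha : 0 < a)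
    (ht : |t| ≤ 1 / 100) (hrule : IsRule Φ)
    (hfeas : ∀ (N : ℕ) (x : Fin N → EuclideanSpace ℝ (Fin 3)), IsGroundState lennardJones x →
      ∀ i : Fin N, eInf ≤ siteE R Φ x i)
    (hstrict : ∀ η : ℝ, 0 < η → ∃ c : ℝ, 0 < c ∧
      ∀ (N : ℕ) (x : Fin N → EuclideanSpace ℝ (Fin 3)), IsGroundState lennardJones x →
        ∀ k : Fin N, siteE R Φ x k < eInf + c → ShellCloseTo η (shell a x k) (target a t))
    (h₂ : ShellRigidityHcp) : _root_.Crystallization := by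
  obtain ⟨P, hP⟩ := defectVanish_of_groundStateCertificate R Φ ha ht hrule hfeas hstrict h₂
  show HasPeriodicGroundStateEnergy lennardJones 3 ∧ IsCrystallizing lennardJones 3
  exact ⟨defectVanishEnergy_proof periodicUpperBound_proof P hP,
    FreeSplittingCertificatesDefectVanishCrystallizes.defectVanishCrystallizes_proof P hP⟩

/-! ## 2. Crux r3 at one hard core; the factorisation of `closes` -/

/-- **Crux r3 gives a ground-state certificate** (its instance at the ground-state hard core `7/10`,
restricted to ground states, which are `7/10`-separated by `LjLaminarWindowsSketch.stub_minDistance07`).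
With `crystallization_of_groundStateCertificate` this re-proves the route's `Assembly`
(`StrictSplittingRule → ShellRigidityHcp → Crystallization`, landed as
`freeSplittingCertificates_assembly_proof`) and shows what `closes` consumes of r3: ONE hard core, ground
states only, any radius.  [folklore] -/
theorem groundStateCertificate_of_strictSplittingRule (h : StrictSplittingRule) :
    ∃ (R : ℝ) (Φ : EuclideanSpace ℝ (Fin 3) → Finset (EuclideanSpace ℝ (Fin 3)) → ℝ) (a t : ℝ),
      0 < a ∧ |t| ≤ 1 / 100 ∧ IsRule Φ ∧
      (∀ (N : ℕ) (x : Fin N → EuclideanSpace ℝ (Fin 3)), IsGroundState lennardJones x →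
        ∀ i : Fin N, eInf ≤ siteE R Φ x i) ∧
      (∀ η : ℝ, 0 < η → ∃ c : ℝ, 0 < c ∧
        ∀ (N : ℕ) (x : Fin N → EuclideanSpace ℝ (Fin 3)), IsGroundState lennardJones x →
          ∀ k : Fin N, siteE R Φ x k < eInf + c → ShellCloseTo η (shell a x k) (target a t)) := by
  obtain ⟨R, Φ, a, t, -, ha, ht, hrule, hfeas, hstrict⟩ :=
    strictSplittingRule_iff.mp h (7 / 10) (by norm_num)
  refine ⟨R, Φ, a, t, ha, ht, hrule,
    fun N x hx i => hfeas N x (LjLaminarWindowsSketch.stub_minDistance07 N x hx) i, fun η hη => ?_⟩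
  obtain ⟨c, hc, hstr⟩ := hstrict η hη
  exact ⟨c, hc, fun N x hx k hk => hstr N x (LjLaminarWindowsSketch.stub_minDistance07 N x hx) k hk⟩

/-- **One hard core suffices.**  If every Lennard-Jones ground state is `δ`-separated, then ONE rule
(any radius `R`) feasible on `δ`-separated configurations and strict toward some `S(a,t)` (`0 < a`,
`|t| ≤ 1/100`) — the `δ`-instance of crux r3 — together with `ShellRigidityHcp` gives `Crystallization`.
Instances: `δ = 7/10` unconditionally (`crystallization_of_strictAt_seven_tenths`); `δ = 4/5` (the hard
core of the decided `R = 2` cell) under the unproved separation `4/5` of ground states.  [folklore] -/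
theorem crystallization_of_strictAt {δ : ℝ}
    (hGS : ∀ (N : ℕ) (x : Fin N → EuclideanSpace ℝ (Fin 3)), IsGroundState lennardJones x → Sep δ x)
    (h₁ : ∃ (R : ℝ) (Φ : EuclideanSpace ℝ (Fin 3) → Finset (EuclideanSpace ℝ (Fin 3)) → ℝ) (a t : ℝ),
      0 < a ∧ |t| ≤ 1 / 100 ∧ IsRule Φ ∧ Feasible δ R Φ ∧ Strict δ R Φ a t)
    (h₂ : ShellRigidityHcp) : _root_.Crystallization := by
  obtain ⟨R, Φ, a, t, ha, ht, hrule, hfeas, hstrict⟩ := h₁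
  refine crystallization_of_groundStateCertificate R Φ ha ht hrule
    (fun N x hx i => hfeas N x (hGS N x hx) i) (fun η hη => ?_) h₂
  obtain ⟨c, hc, hstr⟩ := hstrict η hη
  exact ⟨c, hc, fun N x hx k hk => hstr N x (hGS N x hx) k hk⟩

/-- **The unconditional instance `δ = 7/10`**: a rule feasible on `7/10`-separated configurations and
strict toward some `S(a,t)`, at any radius, plus `ShellRigidityHcp`, gives `Crystallization` — crux r3 is
needed by the summit at the single hard core `7/10` (ground states are `7/10`-separated,
`LjLaminarWindowsSketch.stub_minDistance07`).  [folklore] -/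
theorem crystallization_of_strictAt_seven_tenths
    (h₁ : ∃ (R : ℝ) (Φ : EuclideanSpace ℝ (Fin 3) → Finset (EuclideanSpace ℝ (Fin 3)) → ℝ) (a t : ℝ),
      0 < a ∧ |t| ≤ 1 / 100 ∧ IsRule Φ ∧ Feasible (7 / 10) R Φ ∧ Strict (7 / 10) R Φ a t)
    (h₂ : ShellRigidityHcp) : _root_.Crystallization :=
  crystallization_of_strictAt (fun N x hx => LjLaminarWindowsSketch.stub_minDistance07 N x hx) h₁ h₂

/-! ## 3. Crux r2 at the ground-state hard core -/

/-- **A rung at a ground-state hard core is a finite-range ground-state certificate of feasibility**: if all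
ground states are `δ`-separated, `RungAt δ R` provides a rule `Φ` of radius `R` with `siteE R Φ x i ≥ e_∞`
at every site of every ground state — the hypothesis of the support `SlackDensity` (slack `≥ c` at only
`o(N)` sites), at finite range.  [folklore] -/
theorem groundStateFeasible_of_rungAt {δ R : ℝ}
    (hGS : ∀ (N : ℕ) (x : Fin N → EuclideanSpace ℝ (Fin 3)), IsGroundState lennardJones x → Sep δ x)
    (h : RungAt δ R) :
    ∃ Φ : EuclideanSpace ℝ (Fin 3) → Finset (EuclideanSpace ℝ (Fin 3)) → ℝ, IsRule Φ ∧
      ∀ (N : ℕ) (x : Fin N → EuclideanSpace ℝ (Fin 3)), IsGroundState lennardJones x →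
        ∀ i : Fin N, eInf ≤ siteE R Φ x i := by
  obtain ⟨Φ, hrule, hfeas⟩ := h
  exact ⟨Φ, hrule, fun N x hx i => hfeas N x (hGS N x hx) i⟩

/-- The unconditional instance: a rung at the tree's ground-state hard core `7/10` is a finite-range
feasibility certificate on all Lennard-Jones ground states.  [folklore] -/
theorem groundStateFeasible_of_rungAt_seven_tenths {R : ℝ} (h : RungAt (7 / 10) R) :
    ∃ Φ : EuclideanSpace ℝ (Fin 3) → Finset (EuclideanSpace ℝ (Fin 3)) → ℝ, IsRule Φ ∧
      ∀ (N : ℕ) (x : Fin N → EuclideanSpace ℝ (Fin 3)), IsGroundState lennardJones x →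
        ∀ i : Fin N, eInf ≤ siteE R Φ x i :=
  groundStateFeasible_of_rungAt (fun N x hx => LjLaminarWindowsSketch.stub_minDistance07 N x hx) h

/-- **Crux r2 at the ground-state core**: `FiniteRangeSplitting` gives a rung at hard core `7/10` at some
radius `R ≥ δ_½` (one-instance form `finiteRangeSplitting_iff_rung_two_fifths_floor` at `2/5`, carried up
the hard-core ladder by `rungAt_mono_sep`).  The converse is NOT claimed: hard-core removal
(`rungAt_of_rungAt_two_fifths`) starts from `2/5`, not from `7/10`.  [folklore] -/
theorem rungAt_groundStateCore_of_finiteRangeSplitting (h : FiniteRangeSplitting) :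
    ∃ R : ℝ, halfSumThreshold ≤ R ∧ RungAt (7 / 10) R := by
  obtain ⟨R, hR, hr⟩ := finiteRangeSplitting_iff_rung_two_fifths_floor.mp h
  exact ⟨R, hR, rungAt_mono_sep (by norm_num) hr⟩

/-- **Radius floor at the ground-state core**: every rung at hard core `7/10` reads patterns of radius
`R ≥ δ_½` (`≥ 47/50`): a summit-relevant feasibility certificate sees at least the first coordination
shell (`threshold_le_radius_of_rungAt`, since `7/10 < 47/50 ≤ δ_½`).  [folklore] -/
theorem threshold_le_radius_of_rungAt_seven_tenths {R : ℝ} (h : RungAt (7 / 10) R) :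
    halfSumThreshold ≤ R :=
  threshold_le_radius_of_rungAt (by norm_num) (lt_of_lt_of_le (by norm_num) le_halfSumThreshold_47_50) h

/-- **The decided `R = 2` cell sits above the ground-state core on the hard-core ladder**: a rung at hard
core `7/10` is a rung at the cell's hard core `4/5` at the same radius (`rungAt_mono_sep`).  Contrapositive:
had the `R = 2` recurrent-pattern LP refuted `RungAt (4/5) 2`, no radius-`2` rule could be feasible on
`7/10`-separated configurations — in particular none certified by separation alone on ground states.
[folklore] -/
theorem rungAt_four_fifths_of_rungAt_seven_tenths {R : ℝ} (h : RungAt (7 / 10) R) : RungAt (4 / 5) R :=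
  rungAt_mono_sep (by norm_num) h

/-- **Slack vanishes almost everywhere under a rung at a ground-state hard core** (the summit-side content
of a rung, via the landed support `SlackDensity`): if all ground states are `δ`-separated, `RungAt δ R`
provides a rule `Φ` of radius `R` such that for every `c > 0`, along every sequence of Lennard-Jones ground
states, the fraction of sites whose `Φ`-weighted site energy is `≥ e_∞ + c` tends to `0`
(`slackDensity_proof`: Markov on the non-negative slacks, total `E(N) − N e_∞ = o(N)`).  [folklore] -/
theorem slackVanish_of_rungAt {δ R : ℝ}
    (hGS : ∀ (N : ℕ) (x : Fin N → EuclideanSpace ℝ (Fin 3)), IsGroundState lennardJones x → Sep δ x)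
    (h : RungAt δ R) :
    ∃ Φ : EuclideanSpace ℝ (Fin 3) → Finset (EuclideanSpace ℝ (Fin 3)) → ℝ, IsRule Φ ∧
      ∀ c : ℝ, 0 < c → ∀ x : (N : ℕ) → (Fin N → EuclideanSpace ℝ (Fin 3)),
        (∀ N, IsGroundState lennardJones (x N)) →
          Filter.Tendsto (fun N : ℕ => (Nat.card {k : Fin N // eInf + c ≤ siteE R Φ (x N) k} : ℝ) / N)
            Filter.atTop (nhds 0) := by
  obtain ⟨Φ, hrule, hfeas⟩ := groundStateFeasible_of_rungAt hGS h
  exact ⟨Φ, hrule, fun c hc x hx => slackDensity_proof R Φ hrule hfeas c hc x hx⟩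

/-- The unconditional instance at the tree's ground-state hard core `7/10`: a rung `RungAt (7/10) R` gives
a radius-`R` rule whose slack is `< c` at all but `o(N)` sites of every large ground state, for every
`c > 0`.  [folklore] -/
theorem slackVanish_of_rungAt_seven_tenths {R : ℝ} (h : RungAt (7 / 10) R) :
    ∃ Φ : EuclideanSpace ℝ (Fin 3) → Finset (EuclideanSpace ℝ (Fin 3)) → ℝ, IsRule Φ ∧
      ∀ c : ℝ, 0 < c → ∀ x : (N : ℕ) → (Fin N → EuclideanSpace ℝ (Fin 3)),
        (∀ N, IsGroundState lennardJones (x N)) →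
          Filter.Tendsto (fun N : ℕ => (Nat.card {k : Fin N // eInf + c ≤ siteE R Φ (x N) k} : ℝ) / N)
            Filter.atTop (nhds 0) :=
  slackVanish_of_rungAt (fun N x hx => LjLaminarWindowsSketch.stub_minDistance07 N x hx) h

end Summit.AtomisticToContinuum.Crystallization.Theorems.StrictSplittingRuleBirth

end
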